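import Literature.Analysis.FluidPDE.AncientMildWeak
import HarnessLib

/-!
# Bounded mild solutions on `[0, T)` are bounded weak solutions (mild ⇒ weak in `L^∞`, forward)

Analysis/FluidPDE support file (all results proved): the forward-in-time twin of
`Literature.Analysis.FluidPDE.IsBoundedAncientMildSolution.isBoundedWeakNSSolutionOn`
(`AncientMildWeak.lean`). It is the first bridge in the plan recorded in
`NSCriticalClosureBesovBounded.lean` for the smoothing fact
`Literature.Analysis.FluidPDE.knss_classical_of_bounded_isBesovMildSolutionOn`: the regularity
theory of Koch–Nadirashvili–Seregin–Šverák 2009, §4, is stated for their **bounded weak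
solutions** (`Literature.Analysis.FluidPDE.IsBoundedWeakNSSolutionOn`, arXiv:0709.3599 §4 (ii),
p. 8), whereas the tree's mild solutions (`Fluid.IsMildNSSolutionOn`, the class underlying
`IsBesovMildSolutionOn`) are in the duality form of Fabes–Jones–Rivière: for every `t ∈ [0, T)`
and every smooth compactly supported divergence-free `φ`,
`∫⟪u(t), φ⟫ = ∫⟪u(0), e^{νtΔ}φ⟫ + ∫₀ᵗ ∫⟪u(τ), (u(τ)·∇) e^{ν(t-τ)Δ}φ⟫ dτ`.

* `Literature.Analysis.FluidPDE.isBoundedWeakNSSolutionOn_of_isMildNSSolutionOn`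
  (**mild ⇒ weak in `L^∞`, forward**): a mild solution on `[0, T)` from its own initial slice
  (`0 < ν`), bounded by `M` on `[0, T) × E` with measurable slices and jointly a.e. strongly
  measurable on `(0, T) × E`, is a bounded weak solution on `ℝⁿ × (0, T)` in the sense of KNSS
  (Fabes–Jones–Rivière 1972, Thm. 2.1, (ii) ⇒ (i), in the `L^∞` class of KNSS 2009, §4
  (i)–(ii)).

## Proof

Word for word the proof of the ancient twin with base time `a = 0`: a space–time test field
`ψ` on the slab `(0, T) × E` has time support in some `[a', b]` with `0 < a' ≤ b < T`
(`IsSpaceTimeTestOn.exists_time_support_Ioo`); with `Λ = ∂ₜψ + νΔψ` the identity between `0`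
and `t ∈ (0, b]` tested with `Λ(t)` is the slab integral of the transport integrand
(`integral_inner_sub_eq_slab_of_isMildNSSolutionBetween`, the two-time identity being here the
hypothesis); integrating over `t ∈ (0, b]`, the free term vanishes
(`integral_integral_inner_heatTest_heatAdjointField_eq_zero` with `w = u(0)`), and the nonlinear
term becomes `-∫⟨u, (u·∇)ψ⟩ dτ` by the abstract slab duality
`setIntegral_slab_duality_of_norm_le` and the backward heat equation `𝒰[Λ] = -ψ`. All the
analytic lemmas are those of `AncientMildWeak.lean`, `KatoUniquenessDual.lean`,
`HeatDuhamelBack.lean`.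

## References

* G. Koch, N. Nadirashvili, G. Seregin, V. Šverák, Acta Math. 203 (2009) 83–105 =
  arXiv:0709.3599, §4 (i)–(ii) p. 8, §3 Lemma 3.1 p. 7. [KochNadirashviliSereginSverak2009]
* E. B. Fabes, B. F. Jones, N. M. Rivière, Arch. Rational Mech. Anal. 45 (1972) 222–240,
  Thm. 2.1. [FabesJonesRiviere1972]
-/

noncomputable section

open MeasureTheory Set Function Filter TopologicalSpace InnerProductSpace
open _root_.Topology
open scoped Laplacian RealInnerProductSpace NNReal ENNReal ContDiff

namespace Literature.Analysis.FluidPDE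

variable {E : Type*} [NormedAddCommGroup E] [InnerProductSpace ℝ E] [FiniteDimensional ℝ E]
  [MeasurableSpace E] [BorelSpace E]

/-! ### Time support of test fields on a slab `(S, T) × E` -/

section TestFields

variable {F : Type*} [NormedAddCommGroup F] [NormedSpace ℝ F]

omit [MeasurableSpace E] [BorelSpace E] [FiniteDimensional ℝ E] [InnerProductSpace ℝ E] in
/-- A space–time test field on the slab `(S, T) × E` has its time support in a compact interval
`[a, b]` with `S < a ≤ b < T`, or vanishes identically (the projection of the compact support to
the time axis is compact and contained in `(S, T)`). [folklore] -/
theorem IsSpaceTimeTestOn.exists_time_support_Ioo [NormedSpace ℝ E] {S T : ℝ} (hST : S < T)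
    {ψ : ℝ → E → F} (hψ : IsSpaceTimeTestOn (slab E (Ioo S T) isOpen_Ioo) ψ) :
    ∃ a b : ℝ, S < a ∧ a ≤ b ∧ b < T ∧ ∀ t, t ∉ Icc a b → ψ t = 0 := by
  rcases (tsupport (uncurry ψ)).eq_empty_or_nonempty with h0 | hne
  · have hz : uncurry ψ = 0 := tsupport_eq_empty_iff.1 h0
    refine ⟨(S + T) / 2, (S + T) / 2, by linarith, le_rfl, by linarith,
      fun t _ => funext fun x => ?_⟩
    exact congrFun hz (t, x)
  · have hK : IsCompact (tsupport (uncurry ψ)) := hψ.hasCompactSupport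
    obtain ⟨z₁, hz₁, hmax⟩ := hK.exists_isMaxOn hne continuous_fst.continuousOn
    obtain ⟨z₀, hz₀, hmin⟩ := hK.exists_isMinOn hne continuous_fst.continuousOn
    have hb : z₁.1 < T := (mem_slab.1 (hψ.tsupport_subset hz₁)).2
    have ha : S < z₀.1 := (mem_slab.1 (hψ.tsupport_subset hz₀)).1
    refine ⟨z₀.1, z₁.1, ha, hmin hz₁, hb, fun t ht => funext fun x => ?_⟩
    by_contra hx
    have hmem : (t, x) ∈ tsupport (uncurry ψ) := subset_tsupport _ hx
    exact ht ⟨hmin hmem, hmax hmem⟩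

end TestFields

/-! ### Mild ⇒ weak for bounded, jointly measurable solutions on `[0, T)` -/

section Main

variable {ν : ℝ} {u : ℝ → E → E}

/-- **The tested two-time identity as a slab integral** (forward form; the identity is the
hypothesis). Let `u` be bounded by `M` with measurable slices on `[a, b]` and jointly measurable
on `(a, b] × E`, let `Θ` be a space–time test field with divergence-free slices, `0 < ν`, and
let `t ∈ (a, b]` be a time at which the unforced two-time duality identity between `a` and `t`
holds (`Fluid.IsMildNSSolutionBetween ν 0 u a t`). Then
`∫⟪u(t), Θ(t)⟫ - ∫⟪u(a), e^{ν(t-a)Δ}Θ(t)⟫` equals the integral over the slab `(a, b] × E` of the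
transport integrand `⟪u, K_t u⟫`, `K_t(τ, x) = 1_{τ<t} D(e^{ν(t-τ)Δ}Θ(t))(x)` (Fubini on the slab).
[folklore] -/
theorem integral_inner_sub_eq_slab_of_isMildNSSolutionBetween (hν : 0 < ν) {a b : ℝ} (hab : a ≤ b)
    {M : ℝ} (hM : ∀ τ ∈ Icc a b, ∀ x, ‖u τ x‖ ≤ M)
    (hsl : ∀ τ ∈ Icc a b, AEStronglyMeasurable (u τ) volume)
    (hmeas : AEStronglyMeasurable (uncurry u) ((volume.restrict (Ioc a b)).prod (volume : Measure E)))
    {Θ : ℝ → E → E} (hΘ : IsSpaceTimeTestOn (⊤ : Opens (ℝ × E)) Θ)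
    (hΘd : ∀ t, VectorCalculus.IsDivFree (Θ t)) {t : ℝ} (ht : t ∈ Ioc a b)
    (hid : IsMildNSSolutionBetween ν 0 u a t) :
    (∫ x, ⟪u t x, Θ t x⟫) - ∫ x, ⟪u a x, heatTest ν (Θ t) (t - a) x⟫ =
      ∫ y, ⟪u y.1 y.2, (if y.1 < t then fderiv ℝ (heatTest ν (Θ t) (t - y.1)) y.2 else 0) (u y.1 y.2)⟫
        ∂((volume.restrict (Ioc a b)).prod (volume : Measure E)) := by
  have key := hid (Θ t) (hΘ.isTestFunctionOn_slice t) (hΘd t)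
  have hzero : (∫ τ in a..t, ∫ x, ⟪(0 : ℝ → E → E) τ x, heatTest ν (Θ t) (t - τ) x⟫) = 0 := by simp
  rw [hzero, add_zero] at key
  rw [key, add_sub_cancel_left, intervalIntegral.integral_of_le ht.1.le]
  -- the slab integral, by Fubini
  obtain ⟨R, -, hK1⟩ := hΘ.exists_integral_norm_transportKernel_le hν
  have hslab := integrable_transportIntegrand_slab_of_norm_le (a := u)
    (K := fun (t' : ℝ) (y : ℝ × E) => if y.1 < t' then fderiv ℝ (heatTest ν (Θ t') (t' - y.1)) y.2 else 0)
    (t := t) hab hK1 (hΘ.aestronglyMeasurable_transportKernel_slice hν t _) hmeas hsl hM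
  rw [integral_prod _ hslab.1]
  dsimp only
  -- restrict the time integral on the right to `(a, t]`
  have hvan : ∀ τ, ¬ τ < t → (∫ x, ⟪u τ x,
      (if τ < t then fderiv ℝ (heatTest ν (Θ t) (t - τ)) x else 0) (u τ x)⟫) = 0 := by
    intro τ hτt
    simp [if_neg hτt]
  have e2 : (∫ τ in Ioc a b, ∫ x, ⟪u τ x,
      (if τ < t then fderiv ℝ (heatTest ν (Θ t) (t - τ)) x else 0) (u τ x)⟫) =
      ∫ τ in Ioc a t, ∫ x, ⟪u τ x,
        (if τ < t then fderiv ℝ (heatTest ν (Θ t) (t - τ)) x else 0) (u τ x)⟫ := by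
    have hind : EqOn (fun τ => ∫ x, ⟪u τ x,
        (if τ < t then fderiv ℝ (heatTest ν (Θ t) (t - τ)) x else 0) (u τ x)⟫)
        ((Iic t).indicator fun τ => ∫ x, ⟪u τ x,
          (if τ < t then fderiv ℝ (heatTest ν (Θ t) (t - τ)) x else 0) (u τ x)⟫)
        (Ioc a b) := fun τ _ => by
      by_cases h : τ ≤ t
      · rw [indicator_of_mem (show τ ∈ Iic t from h)]
      · rw [indicator_of_notMem (show τ ∉ Iic t from h)]
        exact hvan τ fun hlt => h hlt.le
    rw [setIntegral_congr_fun measurableSet_Ioc hind, setIntegral_indicator measurableSet_Iic,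
      Ioc_inter_Iic, inf_of_le_right ht.2]
  rw [e2]
  refine setIntegral_congr_ae measurableSet_Ioc ?_
  filter_upwards [measure_eq_zero_iff_ae_notMem.1 (measure_singleton t)] with τ hτt hτ'
  have hlt : τ < t := lt_of_le_of_ne hτ'.2 hτt
  simp only [if_pos hlt, convect_apply]

/-- **Bounded mild solutions on `[0, T)` are bounded weak solutions** (mild ⇒ weak in `L^∞`,
forward form; Koch–Nadirashvili–Seregin–Šverák 2009, §4 (i)–(ii), arXiv:0709.3599 p. 8: the
notions of mild and weak solution in `L^∞(ℝⁿ × (0, T))`, "the considerations of the previous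
section [mild solutions are particular weak solutions, Lemma 3.1] can be repeated with
`f_k = -u_k u`"; Fabes–Jones–Rivière 1972, Thm. 2.1, (ii) ⇒ (i) for the duality formulation). Let
`u` be an unforced mild solution on `[0, T)` from its own initial slice in the tree's duality
form (`Fluid.IsMildNSSolutionOn (Ico 0 T) ν 0 (u 0) u`, `0 < ν`: slices weakly divergence free
and the identity against the caloric test fields `e^{ν(t-τ)Δ}φ`, `φ ∈ C_c^∞` divergence free,
between `0` and every `t < T`), bounded by `M` on `[0, T) × E`, with measurable slices, and
jointly a.e. strongly measurable on `(0, T) × E`. Then `u` is a bounded weak solution on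
`ℝⁿ × (0, T)` in the sense of KNSS (`IsBoundedWeakNSSolutionOn`): for every smooth compactly
supported `ψ` on the open slab with divergence-free slices,
`∫_{0<t<T} ∫ (⟪u, ∂ₜψ⟫ + ⟪u, (u·∇)ψ⟫ + ν⟪u, Δψ⟫) dx dt = 0`.
Proof: with `Λ = ∂ₜψ + νΔψ` and the base time `0` (below the time support `[a', b] ⊂ (0, T)` of
`ψ`), the identity between `0` and `t` tested with `Λ(t)` is integrated over `t ∈ (0, b]`; the
free term gives `⟨u(0), 𝒰[Λ](0)⟩ = -⟨u(0), ψ(0)⟩ = 0` and the nonlinear term, after Fubini on the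
slab, `∫⟨u ⊗ u, ∇𝒰[Λ]⟩ dτ = -∫⟨u, (u·∇)ψ⟩ dτ`, by the backward heat equation `𝒰[∂ₜψ + νΔψ] = -ψ`.
[cite: KochNadirashviliSereginSverak2009, §4 (i)–(ii) (arXiv:0709.3599 p. 8)] -/
theorem isBoundedWeakNSSolutionOn_of_isMildNSSolutionOn {T : ℝ} (hν : 0 < ν) (hT : 0 < T)
    (hu : IsMildNSSolutionOn (Ico 0 T) ν 0 (u 0) u) {M : ℝ} (hM : ∀ t ∈ Ico 0 T, ∀ x, ‖u t x‖ ≤ M)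
    (hsl : ∀ t ∈ Ico 0 T, AEStronglyMeasurable (u t) volume)
    (hmeas : AEStronglyMeasurable (uncurry u) ((volume : Measure (ℝ × E)).restrict (Ioo 0 T ×ˢ univ))) :
    IsBoundedWeakNSSolutionOn (Ioo 0 T) isOpen_Ioo ν u := by
  refine ⟨hmeas, ⟨M, fun t ht x => hM t ⟨ht.1.le, ht.2⟩ x⟩, ?_, fun ψ hψ hdiv => ?_⟩
  · exact (ae_restrict_iff' measurableSet_Ioo).2
      (Eventually.of_forall fun t ht => hu.1 t ⟨ht.1.le, ht.2⟩)
  -- time support of the test field: `[a', b]`, `0 < a' ≤ b < T`; base time `a = 0`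
  obtain ⟨a', b, ha', ha'b, hbT, hsupp⟩ := hψ.exists_time_support_Ioo hT
  have hψ' : IsSpaceTimeTestOn (⊤ : Opens (ℝ × E)) ψ := hψ.mono le_top
  have hab : (0 : ℝ) ≤ b := ha'.le.trans ha'b
  -- the adjoint field `Λ = ∂ₜψ + νΔψ`
  set Λ : ℝ → E → E := fun t x => timeDeriv ψ t x + ν • Δ (ψ t) x with hΛ_def
  have hΛ : IsSpaceTimeTestOn (⊤ : Opens (ℝ × E)) Λ := hψ'.heatAdjointField_top ν
  have hΛd : ∀ t, VectorCalculus.IsDivFree (Λ t) := fun t => hψ'.isDivFree_heatAdjointField hdiv ν t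
  have hΛsupp : ∀ t, t ∉ Icc a' b → Λ t = 0 := fun t ht =>
    heatAdjointField_eq_zero_of_time_support hsupp ν ht
  have hmeas' : AEStronglyMeasurable (uncurry u) ((volume.restrict (Ioc 0 b)).prod (volume : Measure E)) :=
    aestronglyMeasurable_uncurry_restrict_Ioc le_rfl hbT hmeas
  have haτ : ∀ τ ∈ Icc 0 b, AEStronglyMeasurable (u τ) volume := fun τ hτ =>
    hsl τ ⟨hτ.1, hτ.2.trans_lt hbT⟩
  have haM : ∀ τ ∈ Icc 0 b, ∀ x, ‖u τ x‖ ≤ M := fun τ hτ => hM τ ⟨hτ.1, hτ.2.trans_lt hbT⟩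
  have haτ' : ∀ τ ∈ Ioc 0 b, AEStronglyMeasurable (u τ) volume := fun τ hτ =>
    haτ τ (Ioc_subset_Icc_self hτ)
  have haM' : ∀ τ ∈ Ioc 0 b, ∀ x, ‖u τ x‖ ≤ M := fun τ hτ => haM τ (Ioc_subset_Icc_self hτ)
  -- the two-time identity between `0` and `t ∈ (0, b]`
  have hid : ∀ t ∈ Ioc 0 b, IsMildNSSolutionBetween ν 0 u 0 t := fun t ht =>
    isMildNSSolutionFrom_self_iff.1 (hu.2 t ⟨ht.1.le, ht.2.trans_lt hbT⟩)
  -- (1) slab duality for `Λ`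
  obtain ⟨R, -, hK1⟩ := hΛ.exists_integral_norm_transportKernel_le hν
  have hslab : ∀ t ∈ Ioc 0 b, ((∫ x, ⟪u t x, Λ t x⟫) - ∫ x, ⟪u 0 x, heatTest ν (Λ t) (t - 0) x⟫) =
      ∫ y, ⟪u y.1 y.2, (if y.1 < t then fderiv ℝ (heatTest ν (Λ t) (t - y.1)) y.2 else 0) (u y.1 y.2)⟫
        ∂((volume.restrict (Ioc 0 b)).prod (volume : Measure E)) := fun t ht =>
    integral_inner_sub_eq_slab_of_isMildNSSolutionBetween hν hab haM haτ hmeas' hΛ hΛd ht (hid t ht)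
  have h1 : ∫ t in Ioc 0 b, ((∫ x, ⟪u t x, Λ t x⟫) - ∫ x, ⟪u 0 x, heatTest ν (Λ t) (t - 0) x⟫) =
      ∫ τ in Ioc 0 b, ∫ x, ⟪u τ x, fderiv ℝ (heatDuhamelBack ν Λ τ) x (u τ x)⟫ :=
    setIntegral_slab_duality_of_norm_le (a := u)
      (K := fun (t' : ℝ) (y : ℝ × E) => if y.1 < t' then fderiv ℝ (heatTest ν (Λ t') (t' - y.1)) y.2 else 0)
      hab hK1 (hΛ.aestronglyMeasurable_transportKernel hν _)
      (fun t => hΛ.aestronglyMeasurable_transportKernel_slice hν t _) hmeas' haτ haM hslab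
      (fun y hy => ⟨hΛ.integrableOn_transportKernel_time hν 0 b y.1 y.2,
        hΛ.setIntegral_transportKernel_eq_fderiv_heatDuhamelBack hν hΛsupp le_rfl
          (Ioc_subset_Icc_self hy) y.2⟩)
  -- (2) `D𝒰[Λ](τ) = -Dψ(τ)` by the backward heat equation
  have h2 : ∀ τ x, fderiv ℝ (heatDuhamelBack ν Λ τ) x = -fderiv ℝ (ψ τ) x := fun τ x => by
    have h : heatDuhamelBack ν Λ τ = -(ψ τ) :=
      funext fun y => hψ'.heatDuhamelBack_heatAdjointField hν τ y
    rw [h, fderiv_neg]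
  -- (3) the free term vanishes
  have h3 : ∫ t in Ioc 0 b, ∫ x, ⟪u 0 x, heatTest ν (Λ t) (t - 0) x⟫ = 0 :=
    integral_integral_inner_heatTest_heatAdjointField_eq_zero hν (hsl 0 ⟨le_rfl, hT⟩)
      (hM 0 ⟨le_rfl, hT⟩) hψ' hsupp ha' hab le_rfl
  -- integrability in `t` of the slice pairings on `(0, b]`
  have hP : Integrable (fun t => ∫ x, ⟪u t x, Λ t x⟫) (volume.restrict (Ioc 0 b)) :=
    (integrable_prod_inner_test_of_norm_le hmeas' haτ' haM' hΛ).integral_prod_left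
  have hQ : Integrable (fun t => ∫ x, ⟪u t x, fderiv ℝ (ψ t) x (u t x)⟫) (volume.restrict (Ioc 0 b)) :=
    (integrable_prod_inner_convect_test_of_norm_le hmeas' haτ' haM' hψ').integral_prod_left
  have hTr : Integrable (fun t => ∫ y, ⟪u y.1 y.2,
      (if y.1 < t then fderiv ℝ (heatTest ν (Λ t) (t - y.1)) y.2 else 0) (u y.1 y.2)⟫
        ∂((volume.restrict (Ioc 0 b)).prod (volume : Measure E))) (volume.restrict (Ioc 0 b)) :=
    (integrable_transportIntegrand_of_norm_le (a := u)
      (K := fun (t' : ℝ) (y : ℝ × E) => if y.1 < t' then fderiv ℝ (heatTest ν (Λ t') (t' - y.1)) y.2 else 0)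
      hab hK1 (hΛ.aestronglyMeasurable_transportKernel hν _)
      (fun t => hΛ.aestronglyMeasurable_transportKernel_slice hν t _) hmeas' haτ haM).integral_prod_left
  have hPL : Integrable (fun t => (∫ x, ⟪u t x, Λ t x⟫) - ∫ x, ⟪u 0 x, heatTest ν (Λ t) (t - 0) x⟫)
      (volume.restrict (Ioc 0 b)) := by
    refine hTr.congr ?_
    refine (ae_restrict_iff' measurableSet_Ioc).2 (Eventually.of_forall fun t ht => ?_)
    exact (hslab t ht).symm
  have hLt : Integrable (fun t => ∫ x, ⟪u 0 x, heatTest ν (Λ t) (t - 0) x⟫)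
      (volume.restrict (Ioc 0 b)) := by
    refine (hP.sub hPL).congr (Eventually.of_forall fun t => ?_)
    simp only [Pi.sub_apply]
    ring
  -- (4) `∫ ⟨u, Λ⟩ dt = -∫ ⟨u, (u·∇)ψ⟩ dt`
  have h4 : ∫ t in Ioc 0 b, ∫ x, ⟪u t x, Λ t x⟫ =
      -∫ t in Ioc 0 b, ∫ x, ⟪u t x, fderiv ℝ (ψ t) x (u t x)⟫ := by
    have e : (fun t => ∫ x, ⟪u t x, Λ t x⟫) = fun t =>
        ((∫ x, ⟪u t x, Λ t x⟫) - ∫ x, ⟪u 0 x, heatTest ν (Λ t) (t - 0) x⟫) +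
          ∫ x, ⟪u 0 x, heatTest ν (Λ t) (t - 0) x⟫ := by
      funext t; ring
    rw [e, integral_add hPL hLt, h3, add_zero, h1, ← integral_neg]
    refine setIntegral_congr_fun measurableSet_Ioc fun τ _ => ?_
    rw [← integral_neg]
    refine integral_congr_ae (Eventually.of_forall fun x => ?_)
    show ⟪u τ x, fderiv ℝ (heatDuhamelBack ν Λ τ) x (u τ x)⟫ = -⟪u τ x, fderiv ℝ (ψ τ) x (u τ x)⟫
    rw [h2, neg_apply, inner_neg_right]
  -- (5) reduce the weak identity to `(0, b]` and conclude
  have hvan : ∀ t ∈ Ioo (0 : ℝ) T \ Ioc 0 b,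
      (∫ x, (⟪u t x, timeDeriv ψ t x⟫ + ⟪u t x, convect (u t) (ψ t) x⟫ + ν * ⟪u t x, Δ (ψ t) x⟫)) = 0 := by
    intro t ht
    have ht' : t ∉ Icc a' b := fun h => ht.2 ⟨ht.1.1, h.2⟩
    have hψt : ψ t = 0 := hsupp t ht'
    have hdt : timeDeriv ψ t = 0 := timeDeriv_eq_zero_of_time_support hsupp ht'
    have hdt' : ∀ x, deriv (fun s => ψ s x) t = 0 := fun x => by
      have h := congrFun hdt x
      simpa [timeDeriv] using h
    have hΔt : Δ (ψ t) = 0 := by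
      rw [hψt]
      exact InnerProductSpace.laplacian_const (E := E) (c := (0 : E))
    have hDt : ∀ x, fderiv ℝ (ψ t) x = 0 := fun x => by
      rw [hψt]
      exact fderiv_const_apply 0
    simp [hdt', hΔt, hDt]
  rw [setIntegral_eq_of_subset_of_forall_sdiff_eq_zero (s := Ioc 0 b) measurableSet_Ioo
    (fun t ht => (⟨ht.1, ht.2.trans_lt hbT⟩ : t ∈ Ioo 0 T)) hvan]
  have e5 : ∀ t ∈ Ioc 0 b,
      (∫ x, (⟪u t x, timeDeriv ψ t x⟫ + ⟪u t x, convect (u t) (ψ t) x⟫ + ν * ⟪u t x, Δ (ψ t) x⟫)) =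
        (∫ x, ⟪u t x, Λ t x⟫) + ∫ x, ⟪u t x, fderiv ℝ (ψ t) x (u t x)⟫ := by
    intro t ht
    have iP : Integrable (fun x => ⟪u t x, Λ t x⟫) volume :=
      integrable_inner_of_aestronglyMeasurable_of_norm_le (haτ' t ht) (haM' t ht)
        ((hΛ.contDiff_slice t).continuous.integrable_of_hasCompactSupport (hΛ.hasCompactSupport_slice t))
    have iQ : Integrable (fun x => ⟪u t x, fderiv ℝ (ψ t) x (u t x)⟫) volume :=
      (integrable_inner_clm_apply_of_norm_le (haτ' t ht) (haM' t ht)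
        ((hψ'.fderiv_top.contDiff_slice t).continuous.integrable_of_hasCompactSupport
          (hψ'.fderiv_top.hasCompactSupport_slice t))).1
    rw [← integral_add iP iQ]
    refine integral_congr_ae (Eventually.of_forall fun x => ?_)
    simp only [hΛ_def, inner_add_right, real_inner_smul_right, convect_apply]
    ring
  rw [setIntegral_congr_fun measurableSet_Ioc e5, integral_add hP hQ, h4, neg_add_cancel]

end Main

end Literature.Analysis.FluidPDE

end
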